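import Mathlib
import HarnessLib
import Summits.HubbardSuperconductivity.Statement
import Literature.MathematicalPhysics.QuantumLattice.KohnLuttinger
import Literature.MathematicalPhysics.QuantumLattice.DWaveSource
import Literature.MathematicalPhysics.QuantumLattice.PairFieldMomentum
import Summits.HubbardSuperconductivity.HubbardSuperconductivity.Theorems.ChiralWindowCwSsbToEvenTorusLROResidueMap

/-!
Scratch (planner-cstrat-stmt-HubbardSuperconductivity-10439-p1): the two split children of crux
`ChiralWindow.CwSsbToEvenTorusLRO`, spelled exactly as they will be filed (fully qualified, in the
route file's namespace and `open` environment), and the kernel check that the LANDED residue-map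
theorem `cwSsbToEvenTorusLRO_of_slopeFloor_of_infraredLeak` (p106548) has type
`Child₁ → Child₂ → CwSsbToEvenTorusLRO` up to unfolding the two defs.
-/

namespace Summit.HubbardSuperconductivity.HubbardSuperconductivity.Theses.ChiralWindow

open scoped BigOperators Topology Manifold Classical MeasureTheory ProbabilityTheory Matrix InnerProductSpace ComplexConjugate ContinuousMap
open Filter Set Function TopologicalSpace MeasureTheory

open Literature.Hubbard

/-- child 1 (thermodynamic residue S2' = grand-canonical repelled chord floor, "GRC"). -/
def CwGcRepelledChordFloor : Prop :=
  ∃ U₀ : ℝ, 0 < U₀ ∧ ∀ U ∈ Set.Ioo (0:ℝ) U₀, ∀ δ ∈ Set.Ioo (0:ℝ) (1 / 2), ∀ μ : ℝ, Filter.Tendsto (fun L : ℕ => ((Literature.MathematicalPhysics.QuantumLattice.hubbardTorusWith 2 (L + 1) 1 U μ).groundStateFunctional Literature.MathematicalPhysics.QuantumLattice.totalNumber).re / ((L + 1 : ℕ) : ℝ) ^ 2) Filter.atTop (nhds (1 - δ)) → Literature.MathematicalPhysics.QuantumLattice.HasDWaveOrder U μ → ∃ a : ℝ, 0 < a ∧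 ∀ R : ℕ, 0 < R → ∃ κ : ℝ, 0 < κ ∧ ∀ᶠ k : ℕ in Filter.atTop, κ * a * ((2 * k + 1 + 1 : ℕ) : ℝ) ^ 2 ≤ (Literature.MathematicalPhysics.QuantumLattice.hubbardTorusWith 2 (2 * k + 1 + 1) 1 U μ + (κ : ℂ) • (((((R : ℝ) ^ 4)⁻¹ : ℝ) : ℂ) • ∑ a : Literature.Probability.LatticeModels.TorusSite 2 (2 * k + 1 + 1), (∑ u : Fin 2 → Fin R, Literature.MathematicalPhysics.QuantumLattice.localPair Literature.MathematicalPhysics.QuantumLattice.dWaveFormFactor (2 * k + 1 + 1) (a + fun i => ((u i : ℕ) : ZMod (2 * k + 1 + 1))))ᴴ * (∑ u : Fin 2 → Fin R, Literature.MathematicalPhysics.QuantumLattice.localPair Literature.MathematicalPhysics.QuantumLattice.dWaveFormFactor (2 * k + 1 + 1) (a + fun i => ((u i : ℕ) : ZMod (2 * k + 1 + 1)))))).groundEnergy - (Literature.MathematicalPhysics.QuantumLattice.hubbardTorusWith 2 (2 * k + 1 + 1) 1 U μ).groundEnergy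

/-- child 2 (infrared residue S7 = guarded weak-coupling pointwise infrared leak of the d-wave pair structure factor). -/
def CwInfraredLeak : Prop :=
  ∃ U₀ : ℝ, 0 < U₀ ∧ ∀ U ∈ Set.Ioo (0:ℝ) U₀, ∀ δ ∈ Set.Ioo (0:ℝ) (1 / 2), ∀ μ : ℝ, Filter.Tendsto (fun L : ℕ => ((Literature.MathematicalPhysics.QuantumLattice.hubbardTorusWith 2 (L + 1) 1 U μ).groundStateFunctional Literature.MathematicalPhysics.QuantumLattice.totalNumber).re / ((L + 1 : ℕ) : ℝ) ^ 2) Filter.atTop (nhds (1 - δ)) → Literature.MathematicalPhysics.QuantumLattice.HasDWaveOrder U μ → ∀ b : ℝ, 0 < b → ∃ η : ℝ, 0 < η ∧ ∀ᶠ k : ℕ in Filter.atTop, ∀ ψ : Literature.MathematicalPhysics.QuantumLattice.Fock (Literature.MathematicalPhysics.QuantumLattice.Orb (Literature.MathematicalPhysics.QuantumLattice.FermionTorus 2 (2 * k + 1 + 1))), Literature.MathematicalPhysics.QuantumLattice.IsGroundStateInSector (Literature.MathematicalPhysics.QuantumLattice.hubbardTorus 2 (2 * k + 1 + 1) 1 U)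 (2 * ⌊(1 - δ) * ((2 * k + 1 + 1 : ℕ) : ℝ) ^ 2 / 2⌋₊) 0 ψ → star ψ ⬝ᵥ ψ = 1 → (∑ m ∈ (Finset.univ.filter fun m : Literature.Probability.LatticeModels.TorusSite 2 (2 * k + 1 + 1) => m ≠ 0 ∧ Literature.MathematicalPhysics.QuantumLattice.momentumNormSq (2 * k + 1 + 1) m < η ^ 2), Literature.MathematicalPhysics.QuantumLattice.pairStructureFactor Literature.MathematicalPhysics.QuantumLattice.dWaveFormFactor (2 * k + 1 + 1) ψ m) / ((2 * k + 1 + 1 : ℕ) : ℝ) ^ 2 ≤ b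

/-- The glue is LANDED: `Child₁ → Child₂ → parent` is the residue-map theorem, by `exact` (defs unfold). -/
example : CwGcRepelledChordFloor → CwInfraredLeak → CwSsbToEvenTorusLRO :=
  Summit.HubbardSuperconductivity.HubbardSuperconductivity.Theorems.CwSsbToEvenTorusLRO.cwSsbToEvenTorusLRO_of_slopeFloor_of_infraredLeak

/-- Same, through `fun` (the shape of a generated glue item's one-line proof). -/
theorem cwSsbToEvenTorusLRO_of_subs (h₁ : CwGcRepelledChordFloor) (h₂ : CwInfraredLeak) : CwSsbToEvenTorusLRO :=
  Summit.HubbardSuperconductivity.HubbardSuperconductivity.Theorems.CwSsbToEvenTorusLRO.cwSsbToEvenTorusLRO_of_slopeFloor_of_infraredLeak h₁ h₂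

end Summit.HubbardSuperconductivity.HubbardSuperconductivity.Theses.ChiralWindow
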